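import Summits.QuantumFields.YangMills.Theorems.BalabanUVNodesN19JacksonSmoothingC11

/-!
# YM-DAG node N19 (= NE7 proper) — JACKSON SMOOTHING UNDER A MODULUS OF CONTINUITY OF THE DERIVATIVE
# (`|J_L f − f| ≤ 7π⁵·ω(f′, π∕L)∕(32L)`; the remainder `|g(u) − g(a) − g₁(a)(u − a)| ≤ ω(f′, π∕L)·|u − a|` for `|u − a| ≤ π∕L` — module 190's input)

Cell `pub-ymgap`, HUMAN RULING D-0062 (Track A) ∕ D-0149, R141 (C) seat `pub-ymgap-dag-n19-e` (s3 = ALTERNATIVE CURRENCY), generation g35,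
module 7 (lineage module 191).  Route `Summits/QuantumFields/YangMills/Theses/BalabanUVNodes.lean`, cluster item K3⁸ «SpineGivenEndpointR13SepCoPHV»
(stmt-QuantumFields-27366); filed `--supports` that item `--as helper` (it proves no registered stub).  COUNT-NEUTRAL: [folklore]∕[bookkeeping] over
Mathlib (`Convex.norm_image_sub_le_of_norm_hasDerivWithin_le`, `Finset.sum_range_sub`) and, BY NAME, module 185 `…N19JacksonMeanSecondOrder`
(`abs_jacksonMean_le`, `integral_sq_mul_fejerKernel_sq_le`, `integral_mul_fejerKernel_sq_eq_zero`), module 186 `…N19JacksonSmoothingC11`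
(`integral_deriv_mul_cos∕sin`, `periodic_deriv_of_periodic`), module 165 (`jacksonMean_eq_trigSum`, `le_integral_fejerKernel_sq`,
`integral_abs_mul_fejerKernel_sq_le`), module 138 (`abs_fourierCoeff_le`); no laws, no scheme object, no Theses import; NOT a discharge claim.

WHY (desk `numerics/OPEN-PROBLEM.md`).  Modules 165∕167∕176 (Lipschitz `h`: smoothing error `≍ Lip h∕L` ⇒ ONE logarithm at `L ≍ t∕log t`) and
185–189 (Lipschitz `h′`: `≍ Lip h′∕L²` ⇒ NO logarithm) are the two ends of ONE estimate: for `f` `2π`-periodic with a continuous derivative `f₁` whose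
oscillation at scale `π∕L` is `μ` (`|a − b| ≤ π∕L ⇒ |f₁(a) − f₁(b)| ≤ μ`), chaining gives `|f₁(a) − f₁(b)| ≤ (1 + |a − b|L∕π)μ` (§1 `abs_sub_le_chain`),
hence `|f(θ − v) − f(θ) + f₁(θ)v| ≤ μ(|v| + v²L∕π)` and, against the Jackson kernel (`∫|v|f_L² ≤ 3π²`, `∫v²f_L² ≤ 4π³∕L`, `Z ≥ 32L∕π³`),
**`|J_L f − f| ≤ 7π⁵μ∕(32L)`** (§2 `abs_jacksonMean_sub_le_of_modulus`).  The first-order law needs the remainder only at ONE small scale (module 190):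
`|g(u) − g(a) − g₁(a)(u − a)| ≤ μ|u − a|` for `|u − a| ≤ π∕L` passes through the positive kernel (§2 `abs_jacksonMean_taylor_local`).  §3 ★★
`exists_trigLink_near_periodicModulus_jackson` = module 186's package with these two outputs.  The sequels (lineage 192–193): the logarithm of the
general row multiplies ONLY `μ` = the oscillation of `h′` at scale `≍ d·log t∕t`.

HONEST FRAMING (binding).  Elementary and [folklore] (Jackson's theorem with the modulus of continuity of `f′`); NO consumer in the DAG today; nothing
of Bałaban's instantiated; NE7 NOT PRINTED, NOT proved; N19 NOT discharged; count-neutral.  One finite `T⁴` programme at fixed `ε`; nothing continuum ∕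
`ℝ⁴` ∕ OS ∕ mass-gap ∕ Clay.  0 `def` ∕ 0 `sorry`.
-/

noncomputable section

open Finset MeasureTheory intervalIntegral
open scoped Real

namespace Summit.QuantumFields.YangMills.Theorems.BalabanUVNodesN19JacksonSmoothingModulus

open Literature.Probability.LatticeModels (fejerKernel fejerKernel_nonneg)
open Summit.QuantumFields.YangMills.Theorems.BalabanUVNodesN19FejerMean (continuous_fejerKernel abs_fourierCoeff_le)
open Summit.QuantumFields.YangMills.Theorems.BalabanUVNodesN19JacksonKernelMean
  (jacksonMean_eq_trigSum le_integral_fejerKernel_sq integral_abs_mul_fejerKernel_sq_le)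
open Summit.QuantumFields.YangMills.Theorems.BalabanUVNodesN19JacksonMeanSecondOrder
  (abs_jacksonMean_le integral_sq_mul_fejerKernel_sq_le integral_mul_fejerKernel_sq_eq_zero)
open Summit.QuantumFields.YangMills.Theorems.BalabanUVNodesN19JacksonSmoothingC11 (integral_deriv_mul_cos integral_deriv_mul_sin periodic_deriv_of_periodic)

/-! ## §1 Chaining a modulus of continuity [folklore] -/

/-- **CHAINING.**  If `|f₁(a) − f₁(b)| ≤ μ` whenever `|a − b| ≤ δ` (`δ > 0`), then `|f₁(a) − f₁(b)| ≤ (|a − b|∕δ + 1)·μ` for all `a, b`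
(`⌊|a − b|∕δ⌋ + 1` steps of length `≤ δ`). [folklore] -/
theorem abs_sub_le_chain {f₁ : ℝ → ℝ} {δ μ : ℝ} (hδ : 0 < δ) (hmod : ∀ a b, |a - b| ≤ δ → |f₁ a - f₁ b| ≤ μ) (a b : ℝ) :
    |f₁ a - f₁ b| ≤ (|a - b| / δ + 1) * μ := by
  have hμ0 : 0 ≤ μ := (abs_nonneg _).trans (hmod 0 0 (by simp [hδ.le]))
  set n : ℕ := ⌊|a - b| / δ⌋₊ + 1 with hn
  have hn0 : (0 : ℝ) < n := by rw [hn]; positivity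
  have hnle : (n : ℝ) ≤ |a - b| / δ + 1 := by
    rw [hn]; push_cast; linarith only [Nat.floor_le (show 0 ≤ |a - b| / δ by positivity)]
  have hnge : |a - b| / δ < n := by rw [hn]; push_cast; exact Nat.lt_floor_add_one _
  set s : ℝ := (b - a) / n with hs
  have hstep : |s| ≤ δ := by
    rw [hs, abs_div, abs_of_pos hn0, div_le_iff₀ hn0, abs_sub_comm]
    rw [div_lt_iff₀ hδ] at hnge
    linarith only [hnge]
  have htel : f₁ b - f₁ a = ∑ k ∈ range n, (f₁ (a + ((k + 1 : ℕ) : ℝ) * s) - f₁ (a + (k : ℝ) * s)) := by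
    rw [Finset.sum_range_sub (fun k => f₁ (a + (k : ℝ) * s)) n]
    simp only [Nat.cast_zero, zero_mul, add_zero]
    rw [hs, mul_div_cancel₀ _ hn0.ne']
    ring_nf
  rw [abs_sub_comm, htel]
  calc |∑ k ∈ range n, (f₁ (a + ((k + 1 : ℕ) : ℝ) * s) - f₁ (a + (k : ℝ) * s))|
      ≤ ∑ k ∈ range n, |f₁ (a + ((k + 1 : ℕ) : ℝ) * s) - f₁ (a + (k : ℝ) * s)| := abs_sum_le_sum_abs _ _
    _ ≤ ∑ _k ∈ range n, μ := by
        refine Finset.sum_le_sum fun k _ => hmod _ _ ?_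
        rw [show a + ((k + 1 : ℕ) : ℝ) * s - (a + (k : ℝ) * s) = s by push_cast; ring]
        exact hstep
    _ = n * μ := by rw [sum_const, card_range, nsmul_eq_mul]
    _ ≤ (|a - b| / δ + 1) * μ := mul_le_mul_of_nonneg_right hnle hμ0

/-- **TAYLOR AT FIRST ORDER UNDER A MODULUS OF THE DERIVATIVE — local form**: `|u − a| ≤ δ ⇒ |f(u) − f(a) − f₁(a)(u − a)| ≤ μ|u − a|`. [folklore] -/
theorem taylor_abs_le_of_modulus_local {f f₁ : ℝ → ℝ} {δ μ : ℝ} (hder : ∀ θ, HasDerivAt f (f₁ θ) θ)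
    (hmod : ∀ a b, |a - b| ≤ δ → |f₁ a - f₁ b| ≤ μ) {u a : ℝ} (hua : |u - a| ≤ δ) : |f u - f a - f₁ a * (u - a)| ≤ μ * |u - a| := by
  have hφ : ∀ x ∈ Set.uIcc a u, HasDerivWithinAt (fun w => f w - f₁ a * w) (f₁ x - f₁ a) (Set.uIcc a u) x := by
    intro x _
    have h1 : HasDerivAt (fun w => f₁ a * w) (f₁ a) x := by simpa using (hasDerivAt_id x).const_mul (f₁ a)
    exact ((hder x).sub h1).hasDerivWithinAt
  have hbound : ∀ x ∈ Set.uIcc a u, ‖f₁ x - f₁ a‖ ≤ μ := by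
    intro x hx
    rw [Real.norm_eq_abs]
    exact hmod x a ((Set.abs_sub_left_of_mem_uIcc hx).trans hua)
  have key := Convex.norm_image_sub_le_of_norm_hasDerivWithin_le hφ hbound (convex_uIcc a u) Set.left_mem_uIcc Set.right_mem_uIcc
  rw [Real.norm_eq_abs, Real.norm_eq_abs] at key
  rw [show f u - f a - f₁ a * (u - a) = (f u - f₁ a * u) - (f a - f₁ a * a) by ring]
  exact key

/-- **TAYLOR AT FIRST ORDER UNDER A MODULUS OF THE DERIVATIVE — global form**: if `|f₁(x) − f₁(y)| ≤ μ` for `|x − y| ≤ δ` (`δ > 0`), then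
`|f(u) − f(a) − f₁(a)(u − a)| ≤ μ(|u − a| + (u − a)²∕δ)` for all `u, a`. [folklore] -/
theorem taylor_abs_le_of_modulus {f f₁ : ℝ → ℝ} {δ μ : ℝ} (hδ : 0 < δ) (hder : ∀ θ, HasDerivAt f (f₁ θ) θ)
    (hmod : ∀ a b, |a - b| ≤ δ → |f₁ a - f₁ b| ≤ μ) (u a : ℝ) : |f u - f a - f₁ a * (u - a)| ≤ μ * (|u - a| + (u - a) ^ 2 / δ) := by
  have hμ0 : 0 ≤ μ := (abs_nonneg _).trans (hmod 0 0 (by simp [hδ.le]))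
  have hφ : ∀ x ∈ Set.uIcc a u, HasDerivWithinAt (fun w => f w - f₁ a * w) (f₁ x - f₁ a) (Set.uIcc a u) x := by
    intro x _
    have h1 : HasDerivAt (fun w => f₁ a * w) (f₁ a) x := by simpa using (hasDerivAt_id x).const_mul (f₁ a)
    exact ((hder x).sub h1).hasDerivWithinAt
  have hbound : ∀ x ∈ Set.uIcc a u, ‖f₁ x - f₁ a‖ ≤ (|u - a| / δ + 1) * μ := by
    intro x hx
    rw [Real.norm_eq_abs]
    refine (abs_sub_le_chain hδ hmod x a).trans (mul_le_mul_of_nonneg_right ?_ hμ0)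
    exact add_le_add (div_le_div_of_nonneg_right (Set.abs_sub_left_of_mem_uIcc hx) hδ.le) le_rfl
  have key := Convex.norm_image_sub_le_of_norm_hasDerivWithin_le hφ hbound (convex_uIcc a u) Set.left_mem_uIcc Set.right_mem_uIcc
  rw [Real.norm_eq_abs, Real.norm_eq_abs] at key
  rw [show f u - f a - f₁ a * (u - a) = (f u - f₁ a * u) - (f a - f₁ a * a) by ring]
  refine key.trans (le_of_eq ?_)
  rw [show (u - a) ^ 2 = |u - a| * |u - a| by rw [← sq, sq_abs]]
  field_simp
  ring

/-! ## §2 The Jackson mean under a modulus of continuity of `f′` [folklore] -/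

/-- **THE LOCALISED `C¹` REMAINDER PASSES THROUGH THE JACKSON MEAN**: with `g = J_L f`, `g₁ = J_L f₁` and `|u − a| ≤ δ`,
`|g(u) − g(a) − g₁(a)(u − a)| ≤ μ|u − a|`. [folklore] -/
theorem abs_jacksonMean_taylor_local {f f₁ : ℝ → ℝ} {δ μ : ℝ} (hder : ∀ θ, HasDerivAt f (f₁ θ) θ) (hf₁c : Continuous f₁)
    (hmod : ∀ a b, |a - b| ≤ δ → |f₁ a - f₁ b| ≤ μ) {L : ℕ} (hL : 1 ≤ L) {u a : ℝ} (hua : |u - a| ≤ δ) :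
    |(1 / ∫ v in (-π)..π, fejerKernel L v ^ 2) * (∫ v in (-π)..π, f (u - v) * fejerKernel L v ^ 2) -
        (1 / ∫ v in (-π)..π, fejerKernel L v ^ 2) * (∫ v in (-π)..π, f (a - v) * fejerKernel L v ^ 2) -
        (1 / ∫ v in (-π)..π, fejerKernel L v ^ 2) * (∫ v in (-π)..π, f₁ (a - v) * fejerKernel L v ^ 2) * (u - a)| ≤
      μ * |u - a| := by
  have hπ := Real.pi_pos
  have hLr : (0 : ℝ) < L := by exact_mod_cast hL
  set Z : ℝ := ∫ v in (-π)..π, fejerKernel L v ^ 2 with hZ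
  have hZ0 : 0 < Z := lt_of_lt_of_le (by positivity) (le_integral_fejerKernel_sq hL)
  have hfc : Continuous f := continuous_iff_continuousAt.2 fun θ => (hder θ).continuousAt
  have hK : Continuous fun v : ℝ => fejerKernel L v ^ 2 := (continuous_fejerKernel L).pow 2
  have hIu : IntervalIntegrable (fun v => f (u - v) * fejerKernel L v ^ 2) volume (-π) π :=
    ((hfc.comp (continuous_const.sub continuous_id)).mul hK).intervalIntegrable _ _
  have hIa : IntervalIntegrable (fun v => f (a - v) * fejerKernel L v ^ 2) volume (-π) π :=
    ((hfc.comp (continuous_const.sub continuous_id)).mul hK).intervalIntegrable _ _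
  have hI1 : IntervalIntegrable (fun v => f₁ (a - v) * (u - a) * fejerKernel L v ^ 2) volume (-π) π :=
    ((((hf₁c.comp (continuous_const.sub continuous_id))).mul continuous_const).mul hK).intervalIntegrable _ _
  have e1 : (∫ v in (-π)..π, f₁ (a - v) * fejerKernel L v ^ 2) * (u - a) = ∫ v in (-π)..π, f₁ (a - v) * (u - a) * fejerKernel L v ^ 2 := by
    rw [← intervalIntegral.integral_mul_const]
    exact intervalIntegral.integral_congr fun v _ => by ring
  have e2 : (∫ v in (-π)..π, f (u - v) * fejerKernel L v ^ 2) - (∫ v in (-π)..π, f (a - v) * fejerKernel L v ^ 2) -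
      (∫ v in (-π)..π, f₁ (a - v) * (u - a) * fejerKernel L v ^ 2) =
      ∫ v in (-π)..π, (f (u - v) - f (a - v) - f₁ (a - v) * (u - a)) * fejerKernel L v ^ 2 := by
    rw [← intervalIntegral.integral_sub hIu hIa, ← intervalIntegral.integral_sub (hIu.sub hIa) hI1]
    exact intervalIntegral.integral_congr fun v _ => by ring
  have hcomb : (1 / Z) * (∫ v in (-π)..π, f (u - v) * fejerKernel L v ^ 2) - (1 / Z) * (∫ v in (-π)..π, f (a - v) * fejerKernel L v ^ 2) -
      (1 / Z) * (∫ v in (-π)..π, f₁ (a - v) * fejerKernel L v ^ 2) * (u - a) =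
      (1 / Z) * ∫ v in (-π)..π, (f (u - v) - f (a - v) - f₁ (a - v) * (u - a)) * fejerKernel L v ^ 2 := by
    rw [← e2, ← e1]; ring
  rw [hcomb, abs_mul, abs_of_pos (by positivity : (0 : ℝ) < 1 / Z)]
  have hIB : IntervalIntegrable (fun v : ℝ => (μ * |u - a|) * fejerKernel L v ^ 2) volume (-π) π :=
    (continuous_const.mul hK).intervalIntegrable _ _
  have hbound : |∫ v in (-π)..π, (f (u - v) - f (a - v) - f₁ (a - v) * (u - a)) * fejerKernel L v ^ 2| ≤
      ∫ v in (-π)..π, (μ * |u - a|) * fejerKernel L v ^ 2 := by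
    rw [← Real.norm_eq_abs]
    refine intervalIntegral.norm_integral_le_of_norm_le (by linarith) (ae_of_all _ fun v _ => ?_) hIB
    rw [Real.norm_eq_abs, abs_mul, abs_of_nonneg (by positivity : 0 ≤ fejerKernel L v ^ 2)]
    refine mul_le_mul_of_nonneg_right ?_ (by positivity)
    have hua' : |u - v - (a - v)| ≤ δ := by rwa [show u - v - (a - v) = u - a by ring]
    have := taylor_abs_le_of_modulus_local hder hmod hua'
    rwa [show u - v - (a - v) = u - a by ring] at this
  rw [intervalIntegral.integral_const_mul] at hbound
  calc 1 / Z * |∫ v in (-π)..π, (f (u - v) - f (a - v) - f₁ (a - v) * (u - a)) * fejerKernel L v ^ 2|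
      ≤ 1 / Z * (μ * |u - a| * Z) := mul_le_mul_of_nonneg_left hbound (by positivity)
    _ = μ * |u - a| := by field_simp

/-- **THE JACKSON MEAN UNDER A MODULUS OF CONTINUITY OF `f′`**: for `f` with `f′ = f₁` everywhere, `|f₁(a) − f₁(b)| ≤ μ` whenever `|a − b| ≤ π∕L`,
and `L ≥ 1`: `|(1∕Z)∫_{−π}^{π} f(θ − v)f_L(v)² dv − f(θ)| ≤ 7π⁵μ∕(32L)` (the term `−f₁(θ)v` dies on the even kernel; `|remainder| ≤ μ(|v| + v²L∕π)`;
`∫|v|f_L² ≤ 3π²`, `∫v²f_L² ≤ 4π³∕L`, `Z ≥ 32L∕π³`).  `μ ≤ 2sup|f₁|` is module 165's first order, `μ ≤ Lip(f₁)·π∕L` module 185's second order. [folklore] -/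
theorem abs_jacksonMean_sub_le_of_modulus {f f₁ : ℝ → ℝ} {μ : ℝ} (hder : ∀ θ, HasDerivAt f (f₁ θ) θ) {L : ℕ} (hL : 1 ≤ L)
    (hmod : ∀ a b, |a - b| ≤ π / L → |f₁ a - f₁ b| ≤ μ) (θ : ℝ) :
    |(1 / ∫ v in (-π)..π, fejerKernel L v ^ 2) * (∫ v in (-π)..π, f (θ - v) * fejerKernel L v ^ 2) - f θ| ≤ 7 * π ^ 5 * μ / (32 * L) := by
  have hπ := Real.pi_pos
  have hLr : (0 : ℝ) < L := by exact_mod_cast hL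
  have hδ : 0 < π / L := by positivity
  set Z : ℝ := ∫ v in (-π)..π, fejerKernel L v ^ 2 with hZ
  have hZlow := le_integral_fejerKernel_sq hL
  have hZ0 : 0 < Z := lt_of_lt_of_le (by positivity) hZlow
  have hμ0 : 0 ≤ μ := (abs_nonneg _).trans (hmod 0 0 (by simp [hδ.le]))
  have hfc : Continuous f := continuous_iff_continuousAt.2 fun θ => (hder θ).continuousAt
  have hfθ : Continuous fun v => f (θ - v) := hfc.comp (continuous_const.sub continuous_id)
  have hK : Continuous fun v : ℝ => fejerKernel L v ^ 2 := (continuous_fejerKernel L).pow 2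
  have hI1 : IntervalIntegrable (fun v => f (θ - v) * fejerKernel L v ^ 2) volume (-π) π := (hfθ.mul hK).intervalIntegrable _ _
  have hI2 : IntervalIntegrable (fun v => (f θ - f₁ θ * v) * fejerKernel L v ^ 2) volume (-π) π :=
    ((continuous_const.sub (continuous_const.mul continuous_id)).mul hK).intervalIntegrable _ _
  have hI3 : IntervalIntegrable (fun v => f θ * fejerKernel L v ^ 2) volume (-π) π := (continuous_const.mul hK).intervalIntegrable _ _
  have hI4 : IntervalIntegrable (fun v => f₁ θ * (v * fejerKernel L v ^ 2)) volume (-π) π :=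
    (continuous_const.mul (continuous_id.mul hK)).intervalIntegrable _ _
  have hc2 : ∫ v in (-π)..π, (f θ - f₁ θ * v) * fejerKernel L v ^ 2 = f θ * Z := by
    have e : ∫ v in (-π)..π, (f θ - f₁ θ * v) * fejerKernel L v ^ 2 =
        (∫ v in (-π)..π, f θ * fejerKernel L v ^ 2) - ∫ v in (-π)..π, f₁ θ * (v * fejerKernel L v ^ 2) := by
      rw [← intervalIntegral.integral_sub hI3 hI4]
      exact intervalIntegral.integral_congr fun v _ => by ring
    rw [e, intervalIntegral.integral_const_mul, intervalIntegral.integral_const_mul, integral_mul_fejerKernel_sq_eq_zero, mul_zero, sub_zero]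
  have hsub : ∫ v in (-π)..π, (f (θ - v) - f θ - f₁ θ * (-v)) * fejerKernel L v ^ 2 =
      (∫ v in (-π)..π, f (θ - v) * fejerKernel L v ^ 2) - ∫ v in (-π)..π, (f θ - f₁ θ * v) * fejerKernel L v ^ 2 := by
    rw [← intervalIntegral.integral_sub hI1 hI2]
    exact intervalIntegral.integral_congr fun v _ => by ring
  have hdiff : (1 / Z) * (∫ v in (-π)..π, f (θ - v) * fejerKernel L v ^ 2) - f θ =
      (1 / Z) * ∫ v in (-π)..π, (f (θ - v) - f θ - f₁ θ * (-v)) * fejerKernel L v ^ 2 := by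
    rw [hsub, hc2]; field_simp
  rw [hdiff, abs_mul, abs_of_pos (by positivity : (0 : ℝ) < 1 / Z)]
  have hIB : IntervalIntegrable (fun v : ℝ => μ * (|v| * fejerKernel L v ^ 2) + μ * (L / π) * (v ^ 2 * fejerKernel L v ^ 2)) volume (-π) π :=
    ((continuous_const.mul (continuous_abs.mul hK)).add (continuous_const.mul ((continuous_pow 2).mul hK))).intervalIntegrable _ _
  have hbound : |∫ v in (-π)..π, (f (θ - v) - f θ - f₁ θ * (-v)) * fejerKernel L v ^ 2| ≤
      ∫ v in (-π)..π, (μ * (|v| * fejerKernel L v ^ 2) + μ * (L / π) * (v ^ 2 * fejerKernel L v ^ 2)) := by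
    rw [← Real.norm_eq_abs]
    refine intervalIntegral.norm_integral_le_of_norm_le (by linarith) (ae_of_all _ fun v _ => ?_) hIB
    rw [Real.norm_eq_abs, abs_mul, abs_of_nonneg (by positivity : 0 ≤ fejerKernel L v ^ 2)]
    have := taylor_abs_le_of_modulus hδ hder hmod (θ - v) θ
    rw [show θ - v - θ = -v by ring, abs_neg, neg_sq] at this
    have e : μ * (|v| * fejerKernel L v ^ 2) + μ * (L / π) * (v ^ 2 * fejerKernel L v ^ 2) = μ * (|v| + v ^ 2 / (π / L)) * fejerKernel L v ^ 2 := by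
      field_simp
    rw [e]
    exact mul_le_mul_of_nonneg_right this (by positivity)
  have hI5 : IntervalIntegrable (fun v : ℝ => μ * (|v| * fejerKernel L v ^ 2)) volume (-π) π :=
    (continuous_const.mul (continuous_abs.mul hK)).intervalIntegrable _ _
  have hI6 : IntervalIntegrable (fun v : ℝ => μ * (L / π) * (v ^ 2 * fejerKernel L v ^ 2)) volume (-π) π :=
    (continuous_const.mul ((continuous_pow 2).mul hK)).intervalIntegrable _ _
  rw [intervalIntegral.integral_add hI5 hI6, intervalIntegral.integral_const_mul, intervalIntegral.integral_const_mul] at hbound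
  have hm1 := integral_abs_mul_fejerKernel_sq_le hL
  have hm2 := integral_sq_mul_fejerKernel_sq_le hL
  have h7 : μ * (∫ v in (-π)..π, |v| * fejerKernel L v ^ 2) + μ * (L / π) * (∫ v in (-π)..π, v ^ 2 * fejerKernel L v ^ 2) ≤ μ * (7 * π ^ 2) := by
    have e : μ * (7 * π ^ 2) = μ * (3 * π ^ 2) + μ * (L / π) * (4 * π ^ 3 / L) := by field_simp; ring
    rw [e]
    exact add_le_add (mul_le_mul_of_nonneg_left hm1 hμ0) (mul_le_mul_of_nonneg_left hm2 (by positivity))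
  calc 1 / Z * |∫ v in (-π)..π, (f (θ - v) - f θ - f₁ θ * (-v)) * fejerKernel L v ^ 2| ≤ 1 / Z * (μ * (7 * π ^ 2)) :=
        mul_le_mul_of_nonneg_left (hbound.trans h7) (by positivity)
    _ = μ * (7 * π ^ 2) / Z := by ring
    _ ≤ μ * (7 * π ^ 2) / (32 * L / π ^ 3) := div_le_div_of_nonneg_left (by positivity) (by positivity) hZlow
    _ = 7 * π ^ 5 * μ / (32 * L) := by field_simp

/-! ## §3 ★★ The Jackson smoothing package under a modulus of `f′` (module 190's input) [folklore] -/

/-- ★★ **JACKSON SMOOTHING OF A `C¹` PERIODIC FUNCTION UNDER A MODULUS OF ITS DERIVATIVE.**  Let `f : ℝ → ℝ` be `2π`-periodic with a continuous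
derivative `f₁` (`f′ = f₁` everywhere), `|f₁(a) − f₁(b)| ≤ μ` whenever `|a − b| ≤ π∕L` (`L ≥ 1`), `|f₁| ≤ Λ`, `|f| ≤ M`.  Then there are `α, β, ω`
indexed by `p ∈ ((range L × range L) × (range L × range L)) × Bool` (`ω_p ∈ ℕ`, `0 ≤ ω_p ≤ 2L`, `Σ_p(|α_p| + |β_p|) ≤ π⁴ML∕8`) such that the Jackson
mean `g(θ) = Σ_p(α_p cos(ω_pθ) + β_p sin(ω_pθ))` and its formal derivative `g₁` (`= J_L f₁`, by parts) satisfy the LOCALISED remainder bound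
`|g(u) − g(a) − g₁(a)(u − a)| ≤ μ|u − a|` for `|u − a| ≤ π∕L`, `|g₁| ≤ Λ`, and `|g(θ) − f(θ)| ≤ 7π⁵μ∕(32L)` for all reals. [folklore] -/
theorem exists_trigLink_near_periodicModulus_jackson {f f₁ : ℝ → ℝ} {Λ μ M : ℝ} (hper : Function.Periodic f (2 * π))
    (hder : ∀ θ, HasDerivAt f (f₁ θ) θ) (hf₁c : Continuous f₁) {L : ℕ} (hL : 1 ≤ L)
    (hmod : ∀ a b, |a - b| ≤ π / L → |f₁ a - f₁ b| ≤ μ) (hΛ : ∀ θ, |f₁ θ| ≤ Λ) (hM : ∀ w, |f w| ≤ M) :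
    ∃ α β ω : ((ℕ × ℕ) × (ℕ × ℕ)) × Bool → ℝ, (∀ p, 0 ≤ ω p) ∧
      (∀ p ∈ ((range L ×ˢ range L) ×ˢ (range L ×ˢ range L)) ×ˢ (Finset.univ : Finset Bool), ω p ≤ 2 * L) ∧
      (∑ p ∈ ((range L ×ˢ range L) ×ˢ (range L ×ˢ range L)) ×ˢ (Finset.univ : Finset Bool), (|α p| + |β p|) ≤ π ^ 4 * M * L / 8) ∧
      (∀ u a, |u - a| ≤ π / L → |(∑ p ∈ ((range L ×ˢ range L) ×ˢ (range L ×ˢ range L)) ×ˢ (Finset.univ : Finset Bool),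
            (α p * Real.cos (ω p * u) + β p * Real.sin (ω p * u))) -
          (∑ p ∈ ((range L ×ˢ range L) ×ˢ (range L ×ˢ range L)) ×ˢ (Finset.univ : Finset Bool),
            (α p * Real.cos (ω p * a) + β p * Real.sin (ω p * a))) -
          (∑ p ∈ ((range L ×ˢ range L) ×ˢ (range L ×ˢ range L)) ×ˢ (Finset.univ : Finset Bool),
            ω p * (β p * Real.cos (ω p * a) - α p * Real.sin (ω p * a))) * (u - a)| ≤ μ * |u - a|) ∧
      (∀ a, |∑ p ∈ ((range L ×ˢ range L) ×ˢ (range L ×ˢ range L)) ×ˢ (Finset.univ : Finset Bool),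
          ω p * (β p * Real.cos (ω p * a) - α p * Real.sin (ω p * a))| ≤ Λ) ∧
      (∀ θ, |(∑ p ∈ ((range L ×ˢ range L) ×ˢ (range L ×ˢ range L)) ×ˢ (Finset.univ : Finset Bool),
          (α p * Real.cos (ω p * θ) + β p * Real.sin (ω p * θ))) - f θ| ≤ 7 * π ^ 5 * μ / (32 * L)) := by
  have hπ := Real.pi_pos
  have hLr : (0 : ℝ) < L := by exact_mod_cast hL
  have hM0 : 0 ≤ M := (abs_nonneg _).trans (hM 0)
  have hfc : Continuous f := continuous_iff_continuousAt.2 fun θ => (hder θ).continuousAt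
  have hper₁ : Function.Periodic f₁ (2 * π) := periodic_deriv_of_periodic hper hder
  set Z : ℝ := ∫ v in (-π)..π, fejerKernel L v ^ 2 with hZ
  have hZlow : 32 * L / π ^ 3 ≤ Z := le_integral_fejerKernel_sq hL
  have hZ0 : 0 < Z := lt_of_lt_of_le (by positivity) hZlow
  set kp : (ℕ × ℕ) × (ℕ × ℕ) → ℕ := fun q => ((q.1.1 : ℤ) - q.1.2).natAbs + ((q.2.1 : ℤ) - q.2.2).natAbs with hkp
  set km : (ℕ × ℕ) × (ℕ × ℕ) → ℕ := fun q => ((((q.1.1 : ℤ) - q.1.2).natAbs : ℤ) - ((q.2.1 : ℤ) - q.2.2).natAbs).natAbs with hkm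
  set ω : ((ℕ × ℕ) × (ℕ × ℕ)) × Bool → ℝ := fun p => if p.2 then (kp p.1 : ℝ) else (km p.1 : ℝ) with hω
  set a : ((ℕ × ℕ) × (ℕ × ℕ)) × Bool → ℝ := fun p => (1 / (2 * L ^ 2 * Z)) * ∫ w in (-π)..π, f w * Real.cos (ω p * w) with ha
  set b : ((ℕ × ℕ) × (ℕ × ℕ)) × Bool → ℝ := fun p => (1 / (2 * L ^ 2 * Z)) * ∫ w in (-π)..π, f w * Real.sin (ω p * w) with hb
  set Q : Finset ((ℕ × ℕ) × (ℕ × ℕ)) := (range L ×ˢ range L) ×ˢ (range L ×ˢ range L) with hQ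
  set P : Finset (((ℕ × ℕ) × (ℕ × ℕ)) × Bool) := Q ×ˢ (Finset.univ : Finset Bool) with hP
  have hωt : ∀ q, ω (q, true) = (kp q : ℝ) := fun q => by simp [hω]
  have hωf : ∀ q, ω (q, false) = (km q : ℝ) := fun q => by simp [hω]
  have hT : ∀ θ, (1 / Z) * ∫ v in (-π)..π, f (θ - v) * fejerKernel L v ^ 2 =
      ∑ p ∈ P, (a p * Real.cos (ω p * θ) + b p * Real.sin (ω p * θ)) := by
    intro θ
    rw [jacksonMean_eq_trigSum hfc hper L Z θ, hP, Finset.sum_product (s := Q) (t := (Finset.univ : Finset Bool))]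
    refine Finset.sum_congr rfl fun q _ => ?_
    rw [Fintype.sum_bool]
    simp only [ha, hb, hωt, hωf, hkp, hkm]
    ring
  have hT₁ : ∀ θ, (1 / Z) * ∫ v in (-π)..π, f₁ (θ - v) * fejerKernel L v ^ 2 =
      ∑ p ∈ P, ω p * (b p * Real.cos (ω p * θ) - a p * Real.sin (ω p * θ)) := by
    intro θ
    rw [jacksonMean_eq_trigSum hf₁c hper₁ L Z θ, hP, Finset.sum_product (s := Q) (t := (Finset.univ : Finset Bool))]
    refine Finset.sum_congr rfl fun q _ => ?_
    rw [Fintype.sum_bool]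
    simp only [ha, hb, hωt, hωf, hkp, hkm, integral_deriv_mul_cos hper hder hf₁c, integral_deriv_mul_sin hder hf₁c]
    ring
  have hω0 : ∀ p, 0 ≤ ω p := by
    intro p; rw [hω]; show 0 ≤ (if p.2 then (kp p.1 : ℝ) else (km p.1 : ℝ)); split_ifs <;> exact Nat.cast_nonneg _
  refine ⟨a, b, ω, hω0, ?_, ?_, ?_, ?_, ?_⟩
  · intro p hp
    rw [hP, Finset.mem_product, hQ, Finset.mem_product, Finset.mem_product, Finset.mem_product, Finset.mem_range, Finset.mem_range,
      Finset.mem_range, Finset.mem_range] at hp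
    obtain ⟨⟨⟨h11, h12⟩, h21, h22⟩, -⟩ := hp
    have hkp' : kp p.1 ≤ 2 * L := by rw [hkp]; show ((p.1.1.1 : ℤ) - p.1.1.2).natAbs + ((p.1.2.1 : ℤ) - p.1.2.2).natAbs ≤ 2 * L; omega
    have hkm' : km p.1 ≤ 2 * L := by
      rw [hkm]; show ((((p.1.1.1 : ℤ) - p.1.1.2).natAbs : ℤ) - ((p.1.2.1 : ℤ) - p.1.2.2).natAbs).natAbs ≤ 2 * L; omega
    rw [hω]
    show (if p.2 then (kp p.1 : ℝ) else (km p.1 : ℝ)) ≤ 2 * L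
    split_ifs
    · exact_mod_cast hkp'
    · exact_mod_cast hkm'
  · have hc0 : (0 : ℝ) < 1 / (2 * L ^ 2 * Z) := by positivity
    have hcoefZ : 1 / (2 * L ^ 2 * Z) * (2 * π * M) ≤ π ^ 4 * M / (32 * L ^ 3) := by
      have h1 : 1 / (2 * L ^ 2 * Z) ≤ 1 / (2 * L ^ 2 * (32 * L / π ^ 3)) :=
        one_div_le_one_div_of_le (by positivity) (mul_le_mul_of_nonneg_left hZlow (by positivity))
      calc 1 / (2 * L ^ 2 * Z) * (2 * π * M) ≤ 1 / (2 * L ^ 2 * (32 * L / π ^ 3)) * (2 * π * M) :=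
            mul_le_mul_of_nonneg_right h1 (by positivity)
        _ = π ^ 4 * M / (32 * L ^ 3) := by field_simp
    have hcoef : ∀ p ∈ P, |a p| + |b p| ≤ 2 * (π ^ 4 * M / (32 * L ^ 3)) := by
      intro p _
      obtain ⟨hc, hs⟩ := abs_fourierCoeff_le hM (ω p)
      have hc' : |a p| ≤ π ^ 4 * M / (32 * L ^ 3) := by
        rw [ha, abs_mul (1 / (2 * L ^ 2 * Z)) _, abs_of_pos hc0]
        exact (mul_le_mul_of_nonneg_left hc hc0.le).trans hcoefZ
      have hs' : |b p| ≤ π ^ 4 * M / (32 * L ^ 3) := by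
        rw [hb, abs_mul (1 / (2 * L ^ 2 * Z)) _, abs_of_pos hc0]
        exact (mul_le_mul_of_nonneg_left hs hc0.le).trans hcoefZ
      linarith only [hc', hs']
    calc ∑ p ∈ P, (|a p| + |b p|) ≤ ∑ _p ∈ P, 2 * (π ^ 4 * M / (32 * L ^ 3)) := Finset.sum_le_sum hcoef
      _ = (L * L * (L * L) * 2 : ℝ) * (2 * (π ^ 4 * M / (32 * L ^ 3))) := by
          simp only [sum_const, hP, hQ, Finset.card_product, Finset.card_range, Finset.card_univ, Fintype.card_bool, nsmul_eq_mul]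
          push_cast; ring
      _ = π ^ 4 * M * L / 8 := by field_simp; ring
  · intro u v huv
    rw [← hT u, ← hT v, ← hT₁ v]
    exact abs_jacksonMean_taylor_local hder hf₁c hmod hL huv
  · intro θ
    rw [← hT₁ θ]
    exact abs_jacksonMean_le hΛ hL θ
  · intro θ
    rw [← hT θ]
    exact abs_jacksonMean_sub_le_of_modulus hder hL hmod θ

end Summit.QuantumFields.YangMills.Theorems.BalabanUVNodesN19JacksonSmoothingModulus

end
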